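import Literature.Analysis.FluidPDE.BackwardUniquenessChainC12
import HarnessLib

/-!
# Decay of solutions of the backward heat inequality in a cone (Li–Šverák 2012, Lemma 2.2)

Analysis/FluidPDE support file (theorems only; no definitions, no named facts) for the proof of
Li–Šverák's backward-uniqueness theorem in cones
(`Literature.Analysis.FluidPDE.coneBackwardUniquenessC12`). For the cone
`Γ_κ(e) = {x | κ‖x‖ < ⟪x, e⟫}` (`0 ≤ κ ≤ 1`, `‖e‖ = 1`) we use the *gap* `g(x) = ⟪x, e⟫ - κ‖x‖`,
which is positive exactly on `Γ_κ(e)` and `2`-Lipschitz, so that `B̄(x, r) ⊆ Γ_κ(e)` whenever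
`2r < g(x)` (`coneGap_sub_le`); this replaces the distance `d_θ(x)` to the boundary of the cone of
the paper ((2.7): `d_θ(x) ≥ g(x)/2`). With this substitution, Lemma 2.2 of the paper (the decay
`|u(x,t)| ≤ c₂ M e^{-β R²/t}` at the centre of a ball `B_R` on which `u` solves the backward heat
inequality, vanishes initially and is bounded) is Seregin's Lemma A.2 on the balls
`B(x, g(x)/2 - 1)`, and we prove it, for bounded `u` (`|u| ≤ 1`), by running the tree's proof of
`decay_halfspace_c12` (the first Carleman inequality on balls: `core_first_c12`,
`decay_step_c12`, `weight_integral_le`, the `L∞–L²` estimate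
`norm_sq_le_integral_of_backwardHeat_c12` and the interior gradient estimate
`exists_sqrt_gradSq_le_of_backwardHeat_c12`) with the cone-ball geometry:

* `cone_gradient_growth_c12` — `|u| + |∇u| ≤ 1 + 2C(1 + c₁)` on `]0, 1/2[ × {g > 1}`;
* `decay_cone_c12` — Lemma 2.2: `|u(t, x)| ≤ c₂ e^{-β g(x)²/t}` for `0 < t < γ`, `g(x) ≥ 4`;
* `decay_gradient_cone_c12` — the same for `|u| + |∇u|` ((2.9) of the paper, "by local gradient
  estimates for the heat equation"), for `0 < t < γ/2`, `g(x) ≥ 8`.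

## References

* [LiSverak2012] Lu Li, V. Šverák, *Backward uniqueness for the heat equation in cones*,
  Comm. PDE 37 (2012), 1414–1429, arXiv:1011.2796 — Lemma 2.2, (2.8)–(2.9).
* [Seregin2014] G. Seregin, *Lecture notes on regularity theory for the Navier–Stokes
  equations*, World Scientific 2014 — App. A.3, Lemma A.2 (the template).
-/

noncomputable section

open MeasureTheory Set Function Filter Metric
open _root_.Topology
open scoped InnerProductSpace RealInnerProductSpace ENNReal

namespace Literature.Analysis.FluidPDE

namespace Carleman

section ConeDecay

variable {E : Type*} [NormedAddCommGroup E] [InnerProductSpace ℝ E] [FiniteDimensional ℝ E]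
  [MeasurableSpace E] [BorelSpace E]
variable {F : Type*} [NormedAddCommGroup F] [InnerProductSpace ℝ F] [CompleteSpace F]

/-! ### The gap `g(x) = ⟪x, e⟫ - κ‖x‖` of the cone `{κ‖x‖ < ⟪x, e⟫}` -/

omit [FiniteDimensional ℝ E] [MeasurableSpace E] [BorelSpace E] in
/-- **The gap is `2`-Lipschitz**: `g(x) - 2‖y - x‖ ≤ g(y)` for `‖e‖ = 1`, `0 ≤ κ ≤ 1`
(Cauchy–Schwarz and the triangle inequality); in particular `B̄(x, r) ⊆ Γ_κ(e)` if `2r < g(x)`.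
[folklore] -/
theorem coneGap_sub_le {e : E} (he : ‖e‖ = 1) {κ : ℝ} (hκ0 : 0 ≤ κ) (hκ1 : κ ≤ 1) (x y : E) :
    ⟪x, e⟫ - κ * ‖x‖ - 2 * ‖y - x‖ ≤ ⟪y, e⟫ - κ * ‖y‖ := by
  have h1 : |⟪y - x, e⟫| ≤ ‖y - x‖ := by
    have := abs_real_inner_le_norm (y - x) e; rwa [he, mul_one] at this
  rw [inner_sub_left] at h1
  have h2 := (abs_le.1 h1).1
  have h3 : ‖y‖ ≤ ‖x‖ + ‖y - x‖ := norm_le_norm_add_norm_sub' y x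
  have h4 : κ * ‖y‖ ≤ κ * ‖x‖ + κ * ‖y - x‖ := by nlinarith
  have h5 : κ * ‖y - x‖ ≤ ‖y - x‖ := mul_le_of_le_one_left (norm_nonneg _) hκ1
  linarith

omit [FiniteDimensional ℝ E] [MeasurableSpace E] [BorelSpace E] in
/-- The cone `{κ‖x‖ < ⟪x, e⟫}` is open. [folklore] -/
theorem isOpen_coneSet (κ : ℝ) (e : E) : IsOpen {x : E | κ * ‖x‖ < ⟪x, e⟫} :=
  isOpen_lt (continuous_const.mul continuous_norm) (continuous_id.inner continuous_const)

omit [FiniteDimensional ℝ E] [MeasurableSpace E] [BorelSpace E] in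
/-- The region `{c < g}` is open. [folklore] -/
theorem isOpen_coneGap_gt (κ c : ℝ) (e : E) : IsOpen {x : E | c < ⟪x, e⟫ - κ * ‖x‖} :=
  isOpen_lt continuous_const ((continuous_id.inner continuous_const).sub
    (continuous_const.mul continuous_norm))

/-! ### The gradient bound on `{g > 1}` -/

omit [MeasurableSpace E] [BorelSpace E] [CompleteSpace F] in
/-- **The interior gradient bound in the cone** (the case `A = 0` of Seregin's (A.3.7), on the
cylinders `[t, t + 1/4] × B̄(x, 1/2) ⊆ ]0,1[ × Γ_κ(e)` for `g(x) > 1`): there is `C = C(E) > 0`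
such that for `c₁ ≥ 0`, `0 ≤ κ ≤ 1`, a unit vector `e`, and `u` of class `C¹ ∩ {∂ₓu ∈ C¹}` on
`]0,1[ × Γ_κ(e)` with `|∂ₜu + Δu| ≤ c₁(|u| + |∇u|)` and `|u| ≤ 1` there,
`|u| + |∇u| ≤ 1 + 2C(1 + c₁)` on `]0, 1/2[ × {g > 1}`. [cite: LiSverak2012, (2.9)] -/
theorem cone_gradient_growth_c12 : ∃ C : ℝ, 0 < C ∧ ∀ (c₁ κ : ℝ), 0 ≤ c₁ → 0 ≤ κ → κ ≤ 1 →
    ∀ (e : E), ‖e‖ = 1 → ∀ (u : ℝ × E → F),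
      ContDiffOn ℝ 1 u (Ioo (0 : ℝ) 1 ×ˢ {x : E | κ * ‖x‖ < ⟪x, e⟫}) →
      (∀ e' : E, ContDiffOn ℝ 1 (dx e' u) (Ioo (0 : ℝ) 1 ×ˢ {x : E | κ * ‖x‖ < ⟪x, e⟫})) →
      (∀ z ∈ Ioo (0 : ℝ) 1 ×ˢ {x : E | κ * ‖x‖ < ⟪x, e⟫},
        ‖dt u z + lap u z‖ ≤ c₁ * (‖u z‖ + Real.sqrt (gradSq u z))) →
      (∀ z ∈ Ioo (0 : ℝ) 1 ×ˢ {x : E | κ * ‖x‖ < ⟪x, e⟫}, ‖u z‖ ≤ 1) →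
      ∀ z ∈ Ioo (0 : ℝ) (1 / 2) ×ˢ {x : E | 1 < ⟪x, e⟫ - κ * ‖x‖},
        ‖u z‖ + Real.sqrt (gradSq u z) ≤ 1 + 2 * C * (1 + c₁) := by
  obtain ⟨C, hC, hmain⟩ := exists_sqrt_gradSq_le_of_backwardHeat_c12 E F
  refine ⟨C, hC, ?_⟩
  intro c₁ κ hc₁ hκ0 hκ1 e he u hu hux hineq hbound z hz
  obtain ⟨t, x⟩ := z
  obtain ⟨⟨ht0, ht1⟩, hx⟩ := hz
  replace hx : 1 < ⟪x, e⟫ - κ * ‖x‖ := hx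
  set U : Set (ℝ × E) := Ioo (0 : ℝ) 1 ×ˢ {x : E | κ * ‖x‖ < ⟪x, e⟫} with hU
  have hUo : IsOpen U := isOpen_Ioo.prod (isOpen_coneSet κ e)
  have hgap : ∀ y : E, ‖y - x‖ ≤ 1 / 2 → κ * ‖y‖ < ⟪y, e⟫ := by
    intro y hy
    have h := coneGap_sub_le he hκ0 hκ1 x y
    linarith
  have hsub : Icc (t - t / 2) (t + (1 / 2) ^ 2) ×ˢ closedBall x (1 / 2) ⊆ U := by
    rintro ⟨s, y⟩ ⟨⟨hs0, hs1⟩, hy⟩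
    rw [mem_closedBall, dist_eq_norm] at hy
    exact ⟨⟨by linarith, by nlinarith⟩, hgap y hy⟩
  have hcylU : Icc t (t + (1 / 2) ^ 2) ×ˢ closedBall x (1 / 2) ⊆ U := fun z hz =>
    hsub ⟨⟨by linarith [hz.1.1], hz.1.2⟩, hz.2⟩
  have hMb : ∀ z ∈ Icc t (t + (1 / 2) ^ 2) ×ˢ closedBall x (1 / 2), ‖u z‖ ≤ 1 := fun z hz =>
    hbound _ (hcylU hz)
  have hineq' : ∀ z ∈ Icc t (t + (1 / 2) ^ 2) ×ˢ closedBall x (1 / 2),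
      ‖dt u z + lap u z‖ ≤ c₁ * (‖u z‖ + Real.sqrt (gradSq u z)) := fun z hz => hineq z (hcylU hz)
  have hgrad := hmain hUo (by norm_num : (0 : ℝ) < 1 / 2) (by norm_num) (by linarith : 0 < t / 2)
    hc₁ zero_le_one hsub hu hux hineq' hMb
  have hu_le : ‖u (t, x)‖ ≤ 1 :=
    hbound _ ⟨⟨ht0, by linarith⟩, by show κ * ‖x‖ < ⟪x, e⟫; linarith⟩
  calc ‖u (t, x)‖ + Real.sqrt (gradSq u (t, x)) ≤ 1 + C * (1 + c₁) * 1 / (1 / 2) :=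
        add_le_add hu_le hgrad
    _ = 1 + 2 * C * (1 + c₁) := by ring

/-! ### Lemma 2.2: decay in the cone -/

set_option maxHeartbeats 800000 in
/-- **Li–Šverák 2012, Lemma 2.2 (decay in the cone), in the class `C¹₂`** ("Let `B_R` denote the
ball … `|u_t + Δu| ≤ c₁(|∇u| + |u|)` in `B_R × (0,T)`, `u(x,0) = 0` in `B_R`, `|u| < M` … Then
… for `t ∈ (0, γ)`, `u(0, t) ≤ c₂ M e^{-βR²/t}`", applied on the balls `B(x, g(x)/2 - 1) ⊆ Γ_κ(e)`,
as in (2.8): `|u(x,t)| ≤ c₂Me^{-βd_θ²(x)/t}`; here `M = 1`). There is an absolute `β > 0` and for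
every `c₁ ≥ 0` constants `γ ∈ ]0, 1/12]`, `c₂ > 0` (depending on `c₁`, `E`, `F`) such that: if
`0 ≤ κ ≤ 1`, `‖e‖ = 1`, `u` is of class `C¹ ∩ {∂ₓu ∈ C¹}` on `Q = ]0,1[ × Γ_κ(e)`, continuous on
`[0,1[ × Γ_κ(e)` with `u(0, ·) = 0`, `∂ₜu` is square integrable on bounded measurable subsets of
`Q`, `|∂ₜu + Δu| ≤ c₁(|u| + |∇u|)` and `|u| ≤ 1` on `Q`, then
`|u(t, x)| ≤ c₂ e^{-β g(x)²/t}` for all `0 < t < γ` and `g(x) = ⟪x,e⟫ - κ‖x‖ ≥ 4`. The proof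
is Seregin's (Lemma A.2: rescaling to `]1/6, 2[ × B(0, ρ)`, `decay_step_c12`, the `L∞–L²`
estimate), on the ball `B(x, g(x)/2 - 1)`. [cite: LiSverak2012, Lemma 2.2 and (2.8)] -/
theorem decay_cone_c12 : ∃ β : ℝ, 0 < β ∧ ∀ c₁ : ℝ, 0 ≤ c₁ →
    ∃ γ c₂ : ℝ, 0 < γ ∧ γ ≤ 1 / 12 ∧ 0 < c₂ ∧
    ∀ (κ : ℝ), 0 ≤ κ → κ ≤ 1 → ∀ (e : E), ‖e‖ = 1 → ∀ (u : ℝ × E → F),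
      ContDiffOn ℝ 1 u (Ioo (0 : ℝ) 1 ×ˢ {x : E | κ * ‖x‖ < ⟪x, e⟫}) →
      (∀ e' : E, ContDiffOn ℝ 1 (dx e' u) (Ioo (0 : ℝ) 1 ×ˢ {x : E | κ * ‖x‖ < ⟪x, e⟫})) →
      ContinuousOn u (Ico (0 : ℝ) 1 ×ˢ {x : E | κ * ‖x‖ < ⟪x, e⟫}) →
      (∀ x : E, κ * ‖x‖ < ⟪x, e⟫ → u (0, x) = 0) →
      (∀ z ∈ Ioo (0 : ℝ) 1 ×ˢ {x : E | κ * ‖x‖ < ⟪x, e⟫},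
        ‖dt u z + lap u z‖ ≤ c₁ * (‖u z‖ + Real.sqrt (gradSq u z))) →
      (∀ z ∈ Ioo (0 : ℝ) 1 ×ˢ {x : E | κ * ‖x‖ < ⟪x, e⟫}, ‖u z‖ ≤ 1) →
      (∀ K ⊆ Ioo (0 : ℝ) 1 ×ˢ {x : E | κ * ‖x‖ < ⟪x, e⟫}, Bornology.IsBounded K →
        MeasurableSet K → ∫⁻ z in K, ‖dt u z‖ₑ ^ 2 < ∞) →
      ∀ t ∈ Ioo (0 : ℝ) γ, ∀ x : E, 4 ≤ ⟪x, e⟫ - κ * ‖x‖ →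
        ‖u (t, x)‖ ≤ c₂ * Real.exp (-(β * (⟪x, e⟫ - κ * ‖x‖) ^ 2 / t)) := by
  -- ### the constants
  obtain ⟨κcf, Ccf, hκcf, hCcf, hcore⟩ := core_first_c12 (E := E) (F := F)
  obtain ⟨Cw, hCw, hweight⟩ := weight_integral_le E
  obtain ⟨Cg, hCg, hgg⟩ := cone_gradient_growth_c12 (E := E) (F := F)
  obtain ⟨κ₀, hκ₀⟩ : ∃ κ₀ : ℝ, κ₀ = 1 / 256 := ⟨_, rfl⟩
  obtain ⟨L, hL⟩ : ∃ L : ℝ, L = Real.log (hW (3 / 2)) := ⟨_, rfl⟩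
  have hκ₀0 : 0 < κ₀ := by rw [hκ₀]; norm_num
  have hL0 : 0 < L := by rw [hL]; exact log_hW_three_halves_pos
  refine ⟨κ₀ * L / 48, by positivity, fun c₁ hc₁ => ?_⟩
  obtain ⟨c₉, hc₉, h315⟩ := norm_sq_le_integral_of_backwardHeat_c12 (E := E) (F := F) c₁
  set c₃ : ℝ := 1 + 2 * Cg * (1 + c₁) with hc₃
  have hc₃0 : 0 < c₃ := by positivity
  set γ : ℝ := min (1 / 1536) (κcf / (3 * c₁ ^ 2 + 1)) with hγ
  have hγ0 : 0 < γ := lt_min (by norm_num) (by positivity)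
  have hγ1 : γ ≤ 1 / 1536 := min_le_left _ _
  have hγ2 : γ ≤ κcf / (3 * c₁ ^ 2 + 1) := min_le_right _ _
  set Cfin : ℝ := c₉ * (Real.exp (1 / 2) * (Ccf * (c₃ ^ 2 * Cw))) with hCfin
  have hCfin0 : 0 < Cfin := by positivity
  refine ⟨γ, Real.sqrt Cfin + 1, hγ0, hγ1.trans (by norm_num), by positivity, ?_⟩
  intro κ hκ0 hκ1 e he u hu hux hcont h0 hBH hbound hint t ht x hx
  -- ### the cone
  set H : Set E := {x : E | κ * ‖x‖ < ⟪x, e⟫} with hH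
  set Q : Set (ℝ × E) := Ioo (0 : ℝ) 1 ×ˢ H with hQ
  obtain ⟨ht0, htγ⟩ := ht
  have ht1 : t ≤ 1 / 1536 := htγ.le.trans hγ1
  set gx : ℝ := ⟪x, e⟫ - κ * ‖x‖ with hgx
  have hgx4 : 4 ≤ gx := hx
  have hgap : ∀ y : E, gx - 2 * ‖y - x‖ ≤ ⟪y, e⟫ - κ * ‖y‖ := fun y =>
    coneGap_sub_le he hκ0 hκ1 x y
  -- ### the scale `λ = √(3t)` and the radius `ρ = (g(x)/2 - 1)/λ`
  set l : ℝ := Real.sqrt (3 * t) with hl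
  have hl0 : 0 < l := Real.sqrt_pos.2 (by positivity)
  have hl2 : l ^ 2 = 3 * t := Real.sq_sqrt (by positivity)
  have hl1 : l ≤ 1 / 2 := by
    rw [hl, show (1 / 2 : ℝ) = Real.sqrt (1 / 4) by
      rw [show (1 / 4 : ℝ) = (1 / 2) ^ 2 by norm_num, Real.sqrt_sq (by norm_num)]]
    exact Real.sqrt_le_sqrt (by linarith)
  have hl1' : l ≤ 1 := hl1.trans (by norm_num)
  set ρ : ℝ := (gx / 2 - 1) / l with hρ
  have hρl : l * ρ = gx / 2 - 1 := by rw [hρ]; field_simp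
  have hρ2 : 2 ≤ ρ := by rw [hρ, le_div_iff₀ hl0]; nlinarith only [hl1, hgx4]
  have hρ0 : 0 < ρ := by linarith
  have hρsq : 1 ≤ 3 * t * ρ ^ 2 := by
    have h1 : (l * ρ) ^ 2 = l ^ 2 * ρ ^ 2 := by ring
    have h2 : 1 ≤ l * ρ := by rw [hρl]; linarith only [hgx4]
    have h3 : 1 ≤ (l * ρ) ^ 2 := by nlinarith only [h2]
    rw [h1, hl2] at h3
    linarith only [h3]
  have ha2 : 2 ≤ 1 / 256 * ρ ^ 2 := by
    have h512 : (512 : ℝ) ≤ ρ ^ 2 := by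
      by_contra hcon
      push Not at hcon
      have : 3 * t * ρ ^ 2 < 3 * (1 / 1536) * 512 := by nlinarith only [hcon, ht0, ht1, sq_nonneg ρ]
      linarith only [this, hρsq]
    linarith only [h512]
  -- ### the rescaled function `v = u ∘ Φ`, `Φ(s, y) = (λ²s - t/2, x + λy)`
  set Φ : ℝ × E → ℝ × E := stAffine (l ^ 2) l (-(t / 2)) x with hΦdef
  set v : ℝ × E → F := fun z => u (Φ z) with hv
  have hΦ1 : ∀ z : ℝ × E, (Φ z).1 = 3 * t * z.1 - t / 2 := fun z => by
    simp only [hΦdef, stAffine_fst, hl2]; ring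
  have hΦ2 : ∀ z : ℝ × E, (Φ z).2 = x + l • z.2 := fun z => by simp [hΦdef]
  have hΦgap : ∀ z : ℝ × E, ‖z.2‖ < ρ → 1 < ⟪(Φ z).2, e⟫ - κ * ‖(Φ z).2‖ := by
    intro z hz
    rw [hΦ2]
    have h1 := hgap (x + l • z.2)
    have h2 : ‖x + l • z.2 - x‖ = l * ‖z.2‖ := by
      rw [add_sub_cancel_left, norm_smul, Real.norm_eq_abs, abs_of_pos hl0]
    rw [h2] at h1
    have h3 : l * ‖z.2‖ < l * ρ := mul_lt_mul_of_pos_left hz hl0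
    linarith only [h1, h3, hρl]
  -- the domain `O = ]1/6, 2[ × B(0, ρ)` of `v` and its image in `Q`
  set O : Set (ℝ × E) := Ioo (1 / 6 : ℝ) 2 ×ˢ ball (0 : E) ρ with hO
  have hOQ' : O ⊆ Φ ⁻¹' (Ioo (0 : ℝ) (1 / 2) ×ˢ {x : E | 1 < ⟪x, e⟫ - κ * ‖x‖}) := by
    intro z hz
    have hy : ‖z.2‖ < ρ := by have := hz.2; rwa [mem_ball, dist_zero_right] at this
    refine ⟨⟨?_, ?_⟩, hΦgap z hy⟩
    · rw [hΦ1]; nlinarith only [hz.1.1, ht0]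
    · rw [hΦ1]; nlinarith only [hz.1.2, ht0, ht1]
  have hOQ : O ⊆ Φ ⁻¹' Q := by
    intro z hz
    have h := hOQ' hz
    refine ⟨⟨h.1.1, by linarith only [h.1.2]⟩, ?_⟩
    have h2 : 1 < ⟪(Φ z).2, e⟫ - κ * ‖(Φ z).2‖ := h.2
    show κ * ‖(Φ z).2‖ < ⟪(Φ z).2, e⟫
    linarith only [h2]
  -- ### properties of `v` on `O`
  have hvC2 : ContDiffOn ℝ 1 v O := (contDiffOn_comp_stAffine hu (l ^ 2) l (-(t / 2)) x).mono hOQ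
  have hvCx : ∀ e' : E, ContDiffOn ℝ 1 (dx e' v) O := fun e' =>
    (contDiffOn_one_dx_comp_stAffine_c12 (by positivity) hl0.ne' hux (-(t / 2)) x e').mono hOQ
  have hvBH : ∀ z ∈ O, ‖dt v z + lap v z‖ ≤ (c₁ * l) * (‖v z‖ + Real.sqrt (gradSq v z)) :=
    fun z hz => backwardHeat_comp_stAffine hc₁ hl0 hl1' hBH z (hOQ hz)
  have hvBH' : ∀ z ∈ O, ‖dt v z + lap v z‖ ≤ c₁ * (Real.sqrt (gradSq v z) + ‖v z‖) := by
    intro z hz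
    rw [add_comm (Real.sqrt (gradSq v z)) (‖v z‖)]
    exact (hvBH z hz).trans (mul_le_mul_of_nonneg_right (mul_le_of_le_one_right hc₁ hl1')
      (by positivity))
  have hsmall : (c₁ * l) ^ 2 ≤ κcf := by
    have h1 : (c₁ * l) ^ 2 = 3 * c₁ ^ 2 * t := by rw [mul_pow, hl2]; ring
    rw [h1]
    have h2 : t ≤ κcf / (3 * c₁ ^ 2 + 1) := htγ.le.trans hγ2
    rw [le_div_iff₀ (by positivity)] at h2
    have h3 : 0 ≤ c₁ ^ 2 * t := by positivity
    nlinarith only [h2, h3, ht0]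
  -- the bound `|v| + |∇v| ≤ c₃ ≤ c₃ e^{|y|²/64}` on `O`
  have hgg' := hgg c₁ κ hc₁ hκ0 hκ1 e he u hu hux hBH hbound
  have hvbd : ∀ z ∈ O, ‖v z‖ + Real.sqrt (gradSq v z) ≤ c₃ * Real.exp (1 / 64 * ‖z.2‖ ^ 2) := by
    intro z hz
    have h1 := hgg' _ (hOQ' hz)
    have hgv : Real.sqrt (gradSq v z) ≤ Real.sqrt (gradSq u (Φ z)) := by
      rw [hv, gradSq_comp_stAffine (by positivity) hl0.ne', Real.sqrt_mul (sq_nonneg _),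
        Real.sqrt_sq hl0.le]
      exact mul_le_of_le_one_left (Real.sqrt_nonneg _) hl1'
    have h2 : ‖v z‖ + Real.sqrt (gradSq v z) ≤ c₃ := by
      calc ‖v z‖ + Real.sqrt (gradSq v z) ≤ ‖u (Φ z)‖ + Real.sqrt (gradSq u (Φ z)) :=
            add_le_add le_rfl hgv
        _ ≤ c₃ := h1
    have h3 : c₃ ≤ c₃ * Real.exp (1 / 64 * ‖z.2‖ ^ 2) :=
      le_mul_of_one_le_right hc₃0.le (Real.one_le_exp (by positivity))
    exact h2.trans h3
  -- ### the layer data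
  set B : Set E := closedBall (0 : E) (ρ - 1 / 2) with hBdef
  have hBm : MeasurableSet B := measurableSet_closedBall
  have hBρ : B ⊆ ball (0 : E) ρ := closedBall_subset_ball (by linarith only [hρ0])
  have hΦO : ∀ z ∈ Ico (1 / 6 : ℝ) 2 ×ˢ B,
      Φ z ∈ Ico (0 : ℝ) (1 / 2) ×ˢ {x : E | 1 < ⟪x, e⟫ - κ * ‖x‖} := by
    intro z hz
    have hy : ‖z.2‖ < ρ := by
      have := hz.2; rw [mem_closedBall, dist_zero_right] at this; linarith only [this]
    refine ⟨⟨?_, ?_⟩, hΦgap z hy⟩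
    · rw [hΦ1]; nlinarith only [hz.1.1, ht0]
    · rw [hΦ1]; nlinarith only [hz.1.2, ht0, ht1]
  have hIcoO : Ico (1 / 6 : ℝ) 2 ×ˢ B ⊆ Φ ⁻¹' (Ico (0 : ℝ) 1 ×ˢ H) := by
    intro z hz
    have h := hΦO z hz
    have h2 : 1 < ⟪(Φ z).2, e⟫ - κ * ‖(Φ z).2‖ := h.2
    refine ⟨⟨h.1.1, by linarith only [h.1.2]⟩, ?_⟩
    show κ * ‖(Φ z).2‖ < ⟪(Φ z).2, e⟫
    linarith only [h2]
  have hvcont : ContinuousOn v (Ico (1 / 6 : ℝ) (1 / 6 + 11 / 6) ×ˢ B) := by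
    rw [show (1 / 6 : ℝ) + 11 / 6 = 2 by norm_num]
    exact (continuousOn_comp_stAffine hcont (l ^ 2) l (-(t / 2)) x).mono hIcoO
  have hv0 : ∀ y ∈ B, v (1 / 6, y) = 0 := by
    intro y hy
    have hΦy : Φ ((1 / 6 : ℝ), y) = ((0 : ℝ), x + l • y) := by
      refine Prod.ext ?_ ?_
      · rw [hΦ1]; ring
      · rw [hΦ2]
    have hyH : κ * ‖x + l • y‖ < ⟪x + l • y, e⟫ := by
      have h := hΦgap ((1 / 6 : ℝ), y) (by
        have := hBρ hy; rwa [mem_ball, dist_zero_right] at this)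
      rw [hΦ2] at h
      have h' : 1 < ⟪x + l • y, e⟫ - κ * ‖x + l • y‖ := h
      linarith only [h']
    show u (Φ ((1 / 6 : ℝ), y)) = 0
    rw [hΦy]
    exact h0 _ hyH
  have hsubO : Ioo (1 / 6 : ℝ) (1 / 6 + 11 / 6) ×ˢ B ⊆ O := by
    rw [show (1 / 6 : ℝ) + 11 / 6 = 2 by norm_num]
    exact Set.prod_mono Subset.rfl hBρ
  have hfinv : ∫⁻ z in Ioo (1 / 6 : ℝ) (1 / 6 + 11 / 6) ×ˢ B, ‖dt v z‖ₑ ^ 2 < ∞ := by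
    refine setLIntegral_enorm_dt_comp_stAffine_lt_top (by positivity) hl0 (hint _ ?_ ?_ ?_)
    · intro w hw
      obtain ⟨z, hz, rfl⟩ := hw
      exact hOQ (hsubO hz)
    · exact isBounded_image_stAffine (((Metric.isBounded_Icc (1 / 6 : ℝ) (1 / 6 + 11 / 6)).prod
        Metric.isBounded_closedBall).subset (Set.prod_mono Ioo_subset_Icc_self Subset.rfl))
    · exact measurableSet_image_stAffine (by positivity) hl0.ne' (measurableSet_Ioo.prod hBm)
  -- ### the Carleman step
  have hstep := decay_step_c12 (E := E) (F := F) hCcf hcore hweight hρ2 ha2 hvC2 hvCx hvBH hsmall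
    (by norm_num : (0 : ℝ) ≤ 1 / 64) (by norm_num : (1 / 64 : ℝ) ≤ 1 / 32) hc₃0.le hvbd hvcont hv0
    hfinv
  -- ### the `L∞–L²` estimate and the return to `u`
  have hOo : IsOpen O := isOpen_Ioo.prod isOpen_ball
  have hKO' : Icc (1 / 2 : ℝ) 1 ×ˢ closedBall (0 : E) 1 ⊆ O :=
    Set.prod_mono (fun s hs => ⟨by linarith only [hs.1], by linarith only [hs.2]⟩)
      (closedBall_subset_ball (by linarith only [hρ2]))
  have h315' := h315 0 v O hOo hKO' hvC2 hvCx hvBH'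
  have hvtx : v ((1 / 2 : ℝ), (0 : E)) = u (t, x) := by
    show u (Φ ((1 / 2 : ℝ), (0 : E))) = u (t, x)
    congr 1
    refine Prod.ext ?_ ?_
    · rw [hΦ1]; ring
    · rw [hΦ2]; simp
  have hmainsq : ‖u (t, x)‖ ^ 2 ≤ Cfin * hW (3 / 2) ^ (-(2 * (1 / 256 * ρ ^ 2))) := by
    rw [← hvtx]
    calc ‖v ((1 / 2 : ℝ), (0 : E))‖ ^ 2
        ≤ c₉ * ∫ z in Ioo (1 / 2 : ℝ) 1 ×ˢ ball (0 : E) 1, ‖v z‖ ^ 2 := h315'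
      _ ≤ c₉ * (Real.exp (1 / 2) * (Ccf * (c₃ ^ 2 * (Cw * hW (3 / 2) ^ (-(2 * (1 / 256 * ρ ^ 2))))))) :=
          mul_le_mul_of_nonneg_left hstep hc₉.le
      _ = Cfin * hW (3 / 2) ^ (-(2 * (1 / 256 * ρ ^ 2))) := by rw [hCfin]; ring
  -- ### the exponents
  have hh32 : 0 < hW (3 / 2) := lt_trans zero_lt_one one_lt_hW_three_halves
  have hρx : gx ^ 2 ≤ 48 * t * ρ ^ 2 := by
    have h1 : gx / 4 ≤ l * ρ := by rw [hρl]; linarith only [hgx4]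
    have h2 : (gx / 4) ^ 2 ≤ (l * ρ) ^ 2 := pow_le_pow_left₀ (by linarith only [hgx4]) h1 2
    have h3 : (l * ρ) ^ 2 = 3 * t * ρ ^ 2 := by rw [mul_pow, hl2]
    rw [h3] at h2
    linarith only [h2]
  have hexp1 : hW (3 / 2) ^ (-(2 * (1 / 256 * ρ ^ 2))) ≤
      Real.exp (-(κ₀ * L * gx ^ 2 / (24 * t))) := by
    rw [Real.rpow_def_of_pos hh32, ← hL, Real.exp_le_exp, ← hκ₀]
    have : κ₀ * L * gx ^ 2 / (24 * t) ≤ L * (2 * (κ₀ * ρ ^ 2)) := by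
      rw [div_le_iff₀ (by positivity)]
      have h1 := mul_le_mul_of_nonneg_left hρx (mul_pos hκ₀0 hL0).le
      have h2 : κ₀ * L * (48 * t * ρ ^ 2) = L * (2 * (κ₀ * ρ ^ 2)) * (24 * t) := by ring
      linarith only [h1, h2]
    linarith only [this]
  -- ### the final bound
  set R : ℝ := Real.sqrt Cfin * Real.exp (-(κ₀ * L / 48 * gx ^ 2 / t)) with hR
  have hR0 : 0 ≤ R := by positivity
  have hR2 : R ^ 2 = Cfin * Real.exp (-(κ₀ * L * gx ^ 2 / (24 * t))) := by
    have e2 : Real.exp (-(κ₀ * L / 48 * gx ^ 2 / t)) ^ 2 =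
        Real.exp (-(κ₀ * L * gx ^ 2 / (24 * t))) := by
      rw [← Real.exp_nat_mul]; congr 1; push_cast; field_simp; ring
    rw [hR, mul_pow, Real.sq_sqrt hCfin0.le, e2]
  have hsq : ‖u (t, x)‖ ^ 2 ≤ R ^ 2 := by
    rw [hR2]
    exact hmainsq.trans (mul_le_mul_of_nonneg_left hexp1 hCfin0.le)
  have hfin : ‖u (t, x)‖ ≤ R := (pow_le_pow_iff_left₀ (norm_nonneg _) hR0 two_ne_zero).1 hsq
  refine hfin.trans ?_
  rw [hR]
  have hfac : 0 ≤ Real.exp (-(κ₀ * L / 48 * gx ^ 2 / t)) := (Real.exp_pos _).le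
  have := mul_le_mul_of_nonneg_right (by linarith only : Real.sqrt Cfin ≤ Real.sqrt Cfin + 1) hfac
  exact this

/-! ### (2.9): decay of the gradient -/

omit [MeasurableSpace E] [BorelSpace E] [CompleteSpace F] in
/-- **Li–Šverák 2012, (2.9): decay of `|u| + |∇u|` in the cone** ("By local gradient estimates
for the heat equation we can assume that `|u(x,t)| + |∇u(x,t)| ≤ c₃Me^{-βd_θ²(x)/2t}` for all
`(x, t) ∈ O_θ^{+3} × (0, γ/2]`"), in the class `C¹₂` and with the gap `g(x) = ⟪x,e⟫ - κ‖x‖`: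
if `u` is of class `C¹ ∩ {∂ₓu ∈ C¹}` on `]0,1[ × Γ_κ(e)` with `|∂ₜu + Δu| ≤ c₁(|u| + |∇u|)`
there and `|u(t, x)| ≤ c₂ e^{-βg(x)²/t}` for `0 < t < γ`, `g(x) ≥ 4` (`0 < β`, `γ ≤ 1`), then
`|u(t,x)| + |∇u(t,x)| ≤ c₂(1 + C(1 + c₁)((1/2)/(2eβ))^{1/2}) e^{-βg(x)²/(8t)}` for `0 < t < γ/2`,
`g(x) ≥ 8` (the interior gradient estimate `hint` on the cylinders `[t, 2t] × B̄(x, √t)`, on which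
`g ≥ g(x) - 2`). [cite: LiSverak2012, (2.9)] -/
theorem decay_gradient_cone_c12 {C : ℝ} (hC : 0 < C)
    (hint : ∀ ⦃u : ℝ × E → F⦄ ⦃U : Set (ℝ × E)⦄ ⦃c₁ t₀ : ℝ⦄ ⦃x₀ : E⦄ ⦃R δ M : ℝ⦄,
      IsOpen U → 0 < R → R ≤ 1 → 0 < δ → 0 ≤ c₁ → 0 ≤ M →
      Icc (t₀ - δ) (t₀ + R ^ 2) ×ˢ closedBall x₀ R ⊆ U → ContDiffOn ℝ 1 u U →
      (∀ e' : E, ContDiffOn ℝ 1 (dx e' u) U) →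
      (∀ z ∈ Icc t₀ (t₀ + R ^ 2) ×ˢ closedBall x₀ R,
        ‖dt u z + lap u z‖ ≤ c₁ * (‖u z‖ + Real.sqrt (gradSq u z))) →
      (∀ z ∈ Icc t₀ (t₀ + R ^ 2) ×ˢ closedBall x₀ R, ‖u z‖ ≤ M) →
      Real.sqrt (gradSq u (t₀, x₀)) ≤ C * (1 + c₁) * M / R)
    {u : ℝ × E → F} {e : E} (he : ‖e‖ = 1) {κ c₁ c₂ β γ : ℝ} (hκ0 : 0 ≤ κ) (hκ1 : κ ≤ 1)
    (hc₁ : 0 ≤ c₁) (hc₂ : 0 ≤ c₂) (hβ : 0 < β) (hγ1 : γ ≤ 1)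
    (hu : ContDiffOn ℝ 1 u (Ioo (0 : ℝ) 1 ×ˢ {x : E | κ * ‖x‖ < ⟪x, e⟫}))
    (hux : ∀ e' : E, ContDiffOn ℝ 1 (dx e' u) (Ioo (0 : ℝ) 1 ×ˢ {x : E | κ * ‖x‖ < ⟪x, e⟫}))
    (hBH : ∀ z ∈ Ioo (0 : ℝ) 1 ×ˢ {x : E | κ * ‖x‖ < ⟪x, e⟫},
      ‖dt u z + lap u z‖ ≤ c₁ * (‖u z‖ + Real.sqrt (gradSq u z)))
    (hdecay : ∀ t ∈ Ioo (0 : ℝ) γ, ∀ x : E, 4 ≤ ⟪x, e⟫ - κ * ‖x‖ →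
      ‖u (t, x)‖ ≤ c₂ * Real.exp (-(β * (⟪x, e⟫ - κ * ‖x‖) ^ 2 / t))) :
    ∀ t ∈ Ioo (0 : ℝ) (γ / 2), ∀ x : E, 8 ≤ ⟪x, e⟫ - κ * ‖x‖ →
      ‖u (t, x)‖ + Real.sqrt (gradSq u (t, x)) ≤
        c₂ * (1 + C * (1 + c₁) * (1 / 2 / (Real.exp 1 * (2 * β))) ^ (1 / 2 : ℝ)) *
          Real.exp (-(β * (⟪x, e⟫ - κ * ‖x‖) ^ 2 / (8 * t))) := by
  intro t ht x hx
  obtain ⟨ht0, htγ⟩ := ht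
  have ht1 : t ≤ 1 / 2 := by linarith
  set H : Set E := {x : E | κ * ‖x‖ < ⟪x, e⟫} with hH
  set Q : Set (ℝ × E) := Ioo (0 : ℝ) 1 ×ˢ H with hQ
  have hQo : IsOpen Q := isOpen_Ioo.prod (isOpen_coneSet κ e)
  set gx : ℝ := ⟪x, e⟫ - κ * ‖x‖ with hgx
  have hgx8 : 8 ≤ gx := hx
  -- the cylinder `[t/2, 2t] × B̄(x, √t)`
  set R : ℝ := Real.sqrt t with hR
  have hR0 : 0 < R := Real.sqrt_pos.2 ht0
  have hR2 : R ^ 2 = t := Real.sq_sqrt ht0.le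
  have hR1 : R ≤ 1 := by
    rw [hR, show (1 : ℝ) = Real.sqrt 1 by simp]; exact Real.sqrt_le_sqrt (by linarith)
  -- the gap on the ball
  have hball : ∀ ξ ∈ closedBall x R, gx - 2 ≤ ⟪ξ, e⟫ - κ * ‖ξ‖ := by
    intro ξ hξ
    rw [mem_closedBall, dist_eq_norm] at hξ
    have h1 := coneGap_sub_le he hκ0 hκ1 x ξ
    linarith
  have hsubU : Icc (t - t / 2) (t + R ^ 2) ×ˢ closedBall x R ⊆ Q := by
    intro z hz
    have h1 := hball z.2 hz.2
    refine ⟨⟨by linarith [hz.1.1], by rw [hR2] at hz; linarith [hz.1.2]⟩, ?_⟩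
    show κ * ‖z.2‖ < ⟪z.2, e⟫
    linarith
  -- the bound `M` on the cylinder
  set M : ℝ := c₂ * Real.exp (-(β * gx ^ 2 / (4 * t))) with hM
  have hM0 : 0 ≤ M := by positivity
  have hMb : ∀ z ∈ Icc t (t + R ^ 2) ×ˢ closedBall x R, ‖u z‖ ≤ M := by
    intro z hz
    obtain ⟨⟨hz1, hz2⟩, hz3⟩ := hz
    rw [hR2] at hz2
    have h1 := hball z.2 hz3
    have hzn : 4 ≤ ⟪z.2, e⟫ - κ * ‖z.2‖ := by linarith
    have hzt : z.1 ∈ Ioo (0 : ℝ) γ := ⟨by linarith, by linarith⟩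
    have hd := hdecay z.1 hzt z.2 hzn
    rw [Prod.mk.eta] at hd
    refine hd.trans ?_
    rw [hM]
    refine mul_le_mul_of_nonneg_left (Real.exp_le_exp.2 ?_) hc₂
    rw [neg_le_neg_iff, div_le_div_iff₀ (by positivity) (by linarith)]
    -- `β g(x)² z.1 ≤ β g(ξ)² (4t)`: `z.1 ≤ 2t`, `(g(x) - 2)² ≥ g(x)²/2`
    have h5 : gx ^ 2 ≤ 2 * (gx - 2) ^ 2 := by nlinarith
    have h6 : (gx - 2) ^ 2 ≤ (⟪z.2, e⟫ - κ * ‖z.2‖) ^ 2 := pow_le_pow_left₀ (by linarith) h1 2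
    have h7 : z.1 ≤ 2 * t := by linarith
    have h8 : 0 ≤ β * gx ^ 2 := by positivity
    calc β * gx ^ 2 * z.1 ≤ β * gx ^ 2 * (2 * t) := mul_le_mul_of_nonneg_left h7 h8
      _ = β * (gx ^ 2) * 2 * t := by ring
      _ ≤ β * (2 * (gx - 2) ^ 2) * 2 * t := by gcongr
      _ ≤ β * (2 * (⟪z.2, e⟫ - κ * ‖z.2‖) ^ 2) * 2 * t := by gcongr
      _ = β * (⟪z.2, e⟫ - κ * ‖z.2‖) ^ 2 * (4 * t) := by ring
  -- the interior gradient estimate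
  have hBH' : ∀ z ∈ Icc t (t + R ^ 2) ×ˢ closedBall x R,
      ‖dt u z + lap u z‖ ≤ c₁ * (‖u z‖ + Real.sqrt (gradSq u z)) := fun z hz =>
    hBH z (hsubU ⟨⟨by linarith [hz.1.1], hz.1.2⟩, hz.2⟩)
  have hgrad := hint hQo hR0 hR1 (by positivity : (0 : ℝ) < t / 2) hc₁ hM0 hsubU hu hux hBH' hMb
  -- `|u(t,x)| ≤ M`
  have hutx : ‖u (t, x)‖ ≤ M :=
    hMb (t, x) ⟨⟨le_rfl, by linarith [sq_nonneg R]⟩, mem_closedBall_self hR0.le⟩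
  -- the factor `t^{-1/2} e^{-βg²/(8t)} ≤ C_β`
  set Cβ : ℝ := (1 / 2 / (Real.exp 1 * (2 * β))) ^ (1 / 2 : ℝ) with hCβ
  have hCβ0 : 0 ≤ Cβ := Real.rpow_nonneg (by positivity) _
  have hkey : R⁻¹ * Real.exp (-(β * gx ^ 2 / (8 * t))) ≤ Cβ := by
    have h1 : R⁻¹ = t ^ (-(1 / 2 : ℝ)) := by
      rw [hR, Real.sqrt_eq_rpow, ← Real.rpow_neg ht0.le]
    have h2 : Real.exp (-(β * gx ^ 2 / (8 * t))) ≤ Real.exp (-(2 * β / t)) := by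
      rw [Real.exp_le_exp, neg_le_neg_iff, div_le_div_iff₀ ht0 (by positivity)]
      have : (16 : ℝ) ≤ gx ^ 2 := by nlinarith
      have h3 := mul_le_mul_of_nonneg_left this (mul_nonneg hβ.le ht0.le)
      nlinarith [h3]
    rw [h1]
    exact (mul_le_mul_of_nonneg_left h2 (Real.rpow_nonneg ht0.le _)).trans
      (inv_sqrt_mul_exp_le hβ ht0)
  -- splitting `e^{-βg²/(4t)} = e^{-βg²/(8t)} e^{-βg²/(8t)}`
  set G₈ : ℝ := Real.exp (-(β * gx ^ 2 / (8 * t))) with hG₈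
  have hG₈0 : 0 < G₈ := Real.exp_pos _
  have hG₈1 : G₈ ≤ 1 := by
    rw [hG₈, Real.exp_le_one_iff]; exact neg_nonpos.2 (by positivity)
  have hsplit : Real.exp (-(β * gx ^ 2 / (4 * t))) = G₈ * G₈ := by
    rw [hG₈, ← Real.exp_add]; congr 1; field_simp; ring
  have hMP : M = c₂ * G₈ * G₈ := by rw [hM, hsplit]; ring
  -- conclusion
  have h1 : ‖u (t, x)‖ ≤ c₂ * G₈ := by
    refine hutx.trans ?_
    rw [hMP]
    exact mul_le_of_le_one_right (by positivity) hG₈1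
  have h2 : Real.sqrt (gradSq u (t, x)) ≤ C * (1 + c₁) * Cβ * (c₂ * G₈) := by
    refine hgrad.trans ?_
    rw [hMP, div_eq_mul_inv]
    have : C * (1 + c₁) * (c₂ * G₈ * G₈) * R⁻¹ = C * (1 + c₁) * (c₂ * G₈) * (R⁻¹ * G₈) := by ring
    rw [this]
    exact mul_le_mul_of_nonneg_left hkey (by positivity) |>.trans (le_of_eq (by ring))
  calc ‖u (t, x)‖ + Real.sqrt (gradSq u (t, x)) ≤ c₂ * G₈ + C * (1 + c₁) * Cβ * (c₂ * G₈) :=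
        add_le_add h1 h2
    _ = c₂ * (1 + C * (1 + c₁) * Cβ) * G₈ := by ring

end ConeDecay

end Carleman

end Literature.Analysis.FluidPDE
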